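import Mathlib
import HarnessLib
import Summits.HubbardSuperconductivity.HubbardSuperconductivity.Theorems.KLProgrammeKLRegimeEngineScaleZeroValuesDefs
import Summits.HubbardSuperconductivity.HubbardSuperconductivity.Theorems.KLProgrammeKLRegimeEngineV8DefsQ3

/-!
# K3 engine child (`KLRegimeEngineV14`, stmt-HubbardSuperconductivity-19918), stub `stub_engine_scale0`: the scale-`0` smallness
# `klScaleZeroThetaC R · U ≤ 1/2` holds below the engine threshold `klEngU₀3`

Cell gate-hubbard-kl, seat hubbard-kl-k3c2-p1.  The common `U`-condition of the two scale-`0` clauses (`kernelNormsV4_zero_of_klEng`, this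
seat; `pairLadderStepAtV8_zero_of_klEng`, p3 g6) discharged from the engine's binder `0 < U ≤ klEngU₀3 P R c = 1/(2^{120}·Psq²·Rsq⁴·(c²+1))`:
crude dyadic sizes `klScaleZeroA0 ≤ 2^{43}`, `klKappaFrameC R ≤ 2^{13}(Gfr0+1)(Gfr2+1)`, `klScaleZeroCV R ≤ 2^{45}(Gfr0+1)(Gfr2+1)`,
`klScaleZeroThetaC R ≤ 2^{76}(Gfr0+1)(Gfr2+1)`, and `(Gfr0+1)(Gfr2+1) ≤ 4·Rsq²`, so `klScaleZeroThetaC R·U ≤ 2^{-42}`.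

* `klScaleZeroA0_le_two_pow`, `klKappaFrameC_le`, `klScaleZeroCV_le`, `klScaleZeroThetaC_le`,
  **`klScaleZeroThetaC_mul_le_half_of_le_klEngU₀3`**.

Everything is proved; no definitions, no named facts, no sorry.
-/

noncomputable section

namespace Summit.HubbardSuperconductivity.HubbardSuperconductivity.Theorems.EngineV8

set_option linter.dupNamespace false -- summit = problem name (single-conjunct summit), D-0017

open Real Finset
open Summit.HubbardSuperconductivity.HubbardSuperconductivity.Theorems.KLRegimeSplit
open Summit.HubbardSuperconductivity.HubbardSuperconductivity.Theorems.KLProgrammeLegKernels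

/-- `π⁴ < 97.42` and `π⁵ < 306.1`. -/
private theorem pi_pow_bounds : Real.pi ^ 4 < 97.42 ∧ Real.pi ^ 5 < 306.1 := by
  have h := Real.pi_lt_d4
  have h0 := Real.pi_pos.le
  have h4 : Real.pi ^ 4 < 3.1416 ^ 4 := pow_lt_pow_left₀ h h0 (by norm_num)
  have h5 : Real.pi ^ 5 < 3.1416 ^ 5 := pow_lt_pow_left₀ h h0 (by norm_num)
  have n4 : (3.1416 : ℝ) ^ 4 < 97.42 := by norm_num
  have n5 : (3.1416 : ℝ) ^ 5 < 306.1 := by norm_num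
  exact ⟨h4.trans n4, h5.trans n5⟩

/-- **`klScaleZeroA0 ≤ 2^43`.** -/
theorem klScaleZeroA0_le_two_pow : klScaleZeroA0 ≤ (2 : ℝ) ^ 43 := by
  obtain ⟨h4, h5⟩ := pi_pow_bounds
  have hE : klE0 = 1 / 32 := by norm_num [klE0]
  rw [klScaleZeroA0, hE]
  have hX : (1 / 2 + 12 / (1 / 32 : ℝ)) *
      (2 / (1 / 32 : ℝ) + 128 * Real.pi ^ 4 * (4 * (1110 : ℝ) + 6 * (32 / 3) + 2) ^ 2 / (1 / 32 : ℝ) +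
        2 * Real.pi ^ 5 * (4 * (1110 : ℝ) + 6 * (32 / 3) + 2) ^ 2 / (1 / 32 : ℝ) ^ 2 + 1 +
        Real.pi ^ 4 * ((7 : ℝ) ^ 2 * (4 * (1110 : ℝ) + 6 * (32 / 3) + 2) * (2 / (1 / 32 : ℝ)) + 7 * (2 * (32 / 3) + 1)) ^ 2 /
          (1 / 32 : ℝ) ^ 3) ≤ ((2 : ℝ) ^ 43 / 14) ^ 2 := by
    calc (1 / 2 + 12 / (1 / 32 : ℝ)) *
        (2 / (1 / 32 : ℝ) + 128 * Real.pi ^ 4 * (4 * (1110 : ℝ) + 6 * (32 / 3) + 2) ^ 2 / (1 / 32 : ℝ) +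
          2 * Real.pi ^ 5 * (4 * (1110 : ℝ) + 6 * (32 / 3) + 2) ^ 2 / (1 / 32 : ℝ) ^ 2 + 1 +
          Real.pi ^ 4 * ((7 : ℝ) ^ 2 * (4 * (1110 : ℝ) + 6 * (32 / 3) + 2) * (2 / (1 / 32 : ℝ)) + 7 * (2 * (32 / 3) + 1)) ^ 2 /
            (1 / 32 : ℝ) ^ 3)
        ≤ (1 / 2 + 12 / (1 / 32 : ℝ)) *
          (2 / (1 / 32 : ℝ) + 128 * (97.42 : ℝ) * (4 * (1110 : ℝ) + 6 * (32 / 3) + 2) ^ 2 / (1 / 32 : ℝ) +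
            2 * (306.1 : ℝ) * (4 * (1110 : ℝ) + 6 * (32 / 3) + 2) ^ 2 / (1 / 32 : ℝ) ^ 2 + 1 +
            (97.42 : ℝ) * ((7 : ℝ) ^ 2 * (4 * (1110 : ℝ) + 6 * (32 / 3) + 2) * (2 / (1 / 32 : ℝ)) + 7 * (2 * (32 / 3) + 1)) ^ 2 /
              (1 / 32 : ℝ) ^ 3) := by gcongr
      _ ≤ ((2 : ℝ) ^ 43 / 14) ^ 2 := by norm_num
  have hX0 : 0 ≤ ((2 : ℝ) ^ 43 / 14) := by positivity
  calc 14 * Real.sqrt _ ≤ 14 * ((2 : ℝ) ^ 43 / 14) := by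
        refine mul_le_mul_of_nonneg_left ?_ (by norm_num)
        exact (Real.sqrt_le_sqrt hX).trans_eq (Real.sqrt_sq hX0)
    _ = (2 : ℝ) ^ 43 := by ring

/-- **`klKappaFrameC R ≤ 2^13·(Gfr0+1)(Gfr2+1)`** for `Gfr0, Gfr2 ≥ 0`. -/
theorem klKappaFrameC_le {R : RenConsts} (h0 : 0 ≤ R.Gfr 0) (h2 : 0 ≤ R.Gfr 2) :
    klKappaFrameC R ≤ (2 : ℝ) ^ 13 * ((R.Gfr 0 + 1) * (R.Gfr 2 + 1)) := by
  set b : ℝ := (R.Gfr 0 + 1) * (R.Gfr 2 + 1) with hb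
  have hb1 : 1 ≤ b := by rw [hb]; nlinarith
  have hb0 : 0 ≤ b := by linarith
  have hπ := Real.pi_lt_d4
  -- `√(24π²·b) ≤ 16·b`
  have hsq : Real.sqrt (24 * Real.pi ^ 2 * (R.Gfr 0 + 1) * (R.Gfr 2 + 1)) ≤ 16 * b := by
    have hle : 24 * Real.pi ^ 2 * (R.Gfr 0 + 1) * (R.Gfr 2 + 1) ≤ (16 * b) ^ 2 := by
      have : 24 * Real.pi ^ 2 * (R.Gfr 0 + 1) * (R.Gfr 2 + 1) = 24 * Real.pi ^ 2 * b := by rw [hb]; ring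
      rw [this]
      have hπ2 : Real.pi ^ 2 < 10 := by nlinarith [Real.pi_pos]
      nlinarith
    exact (Real.sqrt_le_sqrt hle).trans_eq (Real.sqrt_sq (by positivity))
  have hG0 : R.Gfr 0 + 1 ≤ b := by rw [hb]; nlinarith
  rw [klKappaFrameC]
  nlinarith

/-- **`klScaleZeroCV R ≤ 2^45·(Gfr0+1)(Gfr2+1)`**. -/
theorem klScaleZeroCV_le {R : RenConsts} (h0 : 0 ≤ R.Gfr 0) (h2 : 0 ≤ R.Gfr 2) :
    klScaleZeroCV R ≤ (2 : ℝ) ^ 45 * ((R.Gfr 0 + 1) * (R.Gfr 2 + 1)) := by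
  set b : ℝ := (R.Gfr 0 + 1) * (R.Gfr 2 + 1) with hb
  have hb1 : 1 ≤ b := by rw [hb]; nlinarith
  have hκ := klKappaFrameC_le h0 h2
  rw [← hb] at hκ
  have hκ0 : 0 ≤ klKappaFrameC R := (klKappaFrameC_pos h0).le
  -- `(2e²κ₀)² ≤ 2^22`
  have he2 : Real.exp 2 < 7.39 := by
    have h := Real.exp_one_lt_d9
    have : Real.exp 2 = Real.exp 1 ^ 2 := by rw [← Real.exp_nat_mul]; norm_num
    rw [this]; nlinarith [Real.exp_pos 1]
  have hk : Real.sqrt (2 * (7 + 6047)) ^ 2 = 2 * (7 + 6047) := Real.sq_sqrt (by norm_num)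
  have hc2 : (2 * Real.exp 2 * Real.sqrt (2 * (7 + 6047))) ^ 2 ≤ (2 : ℝ) ^ 22 := by
    rw [mul_pow, hk]
    nlinarith [Real.exp_pos 2]
  have hc4 : (2 * Real.exp 2 * Real.sqrt (2 * (7 + 6047))) ^ 4 ≤ (2 : ℝ) ^ 44 := by
    have : (2 * Real.exp 2 * Real.sqrt (2 * (7 + 6047))) ^ 4 = ((2 * Real.exp 2 * Real.sqrt (2 * (7 + 6047))) ^ 2) ^ 2 := by ring
    rw [this]
    calc ((2 * Real.exp 2 * Real.sqrt (2 * (7 + 6047))) ^ 2) ^ 2 ≤ ((2 : ℝ) ^ 22) ^ 2 :=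
          pow_le_pow_left₀ (by positivity) hc2 2
      _ = (2 : ℝ) ^ 44 := by norm_num
  rw [klScaleZeroCV]
  nlinarith [mul_le_mul hc2 hκ hκ0 (by positivity)]

/-- **`klScaleZeroThetaC R ≤ 2^76·(Gfr0+1)(Gfr2+1)`**. -/
theorem klScaleZeroThetaC_le {R : RenConsts} (h0 : 0 ≤ R.Gfr 0) (h2 : 0 ≤ R.Gfr 2) :
    klScaleZeroThetaC R ≤ (2 : ℝ) ^ 76 * ((R.Gfr 0 + 1) * (R.Gfr 2 + 1)) := by
  set b : ℝ := (R.Gfr 0 + 1) * (R.Gfr 2 + 1) with hb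
  have hb0 : 0 ≤ b := by rw [hb]; positivity
  have hA := klScaleZeroA0_le_two_pow
  have hA0 := klScaleZeroA0_pos.le
  have hCV := klScaleZeroCV_le h0 h2
  rw [← hb] at hCV
  have hCV0 := (klScaleZeroCV_pos h0).le
  have he : Real.exp 1 < 2.72 := by have := Real.exp_one_lt_d9; linarith
  have hk : Real.sqrt (2 * (7 + 6047)) ^ 2 = 2 * (7 + 6047) := Real.sq_sqrt (by norm_num)
  rw [klScaleZeroThetaC, hk, div_le_iff₀ (by norm_num)]
  have h1 : Real.exp 1 * klScaleZeroA0 * klScaleZeroCV R ≤ 2.72 * (2 : ℝ) ^ 43 * ((2 : ℝ) ^ 45 * b) := by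
    have := mul_le_mul (mul_le_mul he.le hA hA0 (by norm_num)) hCV hCV0 (by positivity)
    linarith
  nlinarith

/-- **The scale-`0` smallness below the engine threshold**: `R.WF`, `0 < U ≤ klEngU₀3 P R c` ⇒ `klScaleZeroThetaC R · U ≤ 1/2`. -/
theorem klScaleZeroThetaC_mul_le_half_of_le_klEngU₀3 {P : SplitConsts} {R : RenConsts} (hR : R.WF) {c U : ℝ} (hU : 0 < U)
    (hU₀ : U ≤ klEngU₀3 P R c) : klScaleZeroThetaC R * U ≤ 1 / 2 := by
  have hG := hR.2.2
  have hθ := klScaleZeroThetaC_le (hG 0) (hG 2)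
  have hθ0 := (klScaleZeroThetaC_pos (hG 0)).le
  have hRsq1 : 1 ≤ klEngRsq R := one_le_klEngRsq R
  have hPsq1 : 1 ≤ klEngPsq P := one_le_klEngPsq P
  have hG0 : R.Gfr 0 ≤ klEngRsq R := gfr_le_klEngRsq R (by norm_num)
  have hG2 : R.Gfr 2 ≤ klEngRsq R := gfr_le_klEngRsq R (by norm_num)
  -- `U ≤ 1/(2^120 Rsq⁴)` and `(Gfr0+1)(Gfr2+1) ≤ 4 Rsq²`
  have hden : (2 : ℝ) ^ 120 * klEngRsq R ^ 4 ≤ (2 : ℝ) ^ 120 * klEngPsq P ^ 2 * klEngRsq R ^ 4 * (c ^ 2 + 1) := by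
    have h2' : (1 : ℝ) ≤ klEngPsq P ^ 2 := one_le_pow₀ hPsq1
    have h3 : (1 : ℝ) ≤ c ^ 2 + 1 := by nlinarith [sq_nonneg c]
    have hR0 : 0 ≤ klEngRsq R ^ 4 := by positivity
    calc (2 : ℝ) ^ 120 * klEngRsq R ^ 4 = (2 : ℝ) ^ 120 * 1 * klEngRsq R ^ 4 * 1 := by ring
      _ ≤ _ := by gcongr
  have hUle : U ≤ 1 / ((2 : ℝ) ^ 120 * klEngRsq R ^ 4) := by
    refine hU₀.trans ?_
    rw [klEngU₀3]
    exact one_div_le_one_div_of_le (by positivity) hden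
  have hb : (R.Gfr 0 + 1) * (R.Gfr 2 + 1) ≤ 4 * klEngRsq R ^ 2 := by nlinarith [hG 0, hG 2]
  calc klScaleZeroThetaC R * U ≤ ((2 : ℝ) ^ 76 * (4 * klEngRsq R ^ 2)) * (1 / ((2 : ℝ) ^ 120 * klEngRsq R ^ 4)) :=
        mul_le_mul (hθ.trans (by nlinarith)) hUle hU.le (by positivity)
    _ = 1 / ((2 : ℝ) ^ 42 * klEngRsq R ^ 2) := by field_simp; ring
    _ ≤ 1 / (2 : ℝ) ^ 42 := by
        refine one_div_le_one_div_of_le (by positivity) ?_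
        have : (1 : ℝ) ≤ klEngRsq R ^ 2 := one_le_pow₀ hRsq1
        nlinarith
    _ ≤ 1 / 2 := by norm_num

end Summit.HubbardSuperconductivity.HubbardSuperconductivity.Theorems.EngineV8

end
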